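import Summits.CriticalPhenomena.SAWScalingLimit.Theses.SAWPoincareChain
import Summits.CriticalPhenomena.SAWScalingLimit.Theorems.SAWPoincareChainDiscRestrictionIsSLETransport

/-!
# Birth skeleton (`Lines/birth.lean`) for crux `ChainLaw` (stmt-CriticalPhenomena-7556)

Route `SAWPoincareChain` of `CriticalPhenomena/SAWScalingLimit`, crux r3 `ChainLaw` — the
CONSTRUCTION statement of the route's posited object: `∃ Q : ℝ → ChordalFamily` such that for all
small `t > 0` the family `Q t` is chordal, EXACTLY conformally covariant, and `Q t (𝔻; 1, −1)` is
the weak limit, as the first bead `ρ = 1 − r → 1⁻`, of the normalised `x_c`-weighted Poincaré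
tangent-bead chain measures (inlined in the crux; here named `approximant t r`, normalised
`approxLaw t r`, copied VERBATIM from the route decl so that the composition below concludes the
crux BY NAME).

## The line (the route header's own two-layer plan `ChainLaw ⇐ TwoPointFinite → AxisRenewal →
ChainLaw`, with the "transport to all D" glue PROVED here from the tree)

* `stub_twoPointFinite : TwoPointFinite` (L; the typed "why it might fail" of the crux) — at the
  flat critical fugacity `x_c = 1/μ_flat` and every small step parameter `t`, the grand-canonical
  mass `Z(t, ρ) = approximant t r univ` of chains from `ρ = 1 − r` to the pseudo-hyperbolic ball
  `B(−ρ, 1/2)` is neither `0` nor `∞`, for EVERY start `ρ ∈ (0, 1)`.  Non-vanishing is elementary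
  (nearly geodesic chains along the axis have positive angle-volume); finiteness is the two-point
  finiteness of the hyperbolic `t`-chain at the FLAT critical fugacity (bulk mass per unit
  hyperbolic length `m > 1/2`, predicted `5/8`): `x_c^flat > 1/μ_hyp(t)` makes the susceptibility
  infinite, so only the exponential volume growth of `ℍ²` can make the two-point function finite —
  this is exactly the bet recorded on the item, isolated.
* `stub_discLimit : TwoPointFinite → DiscLimitExists` (XL; HARDEST — "axis renewal") — given
  finiteness, the normalised laws `approxLaw t r` converge weakly on `CurveClass ℂ` as `r → 0⁺`
  to a probability law carried by curves of the closed disc from `1` to `−1` (the bi-infinite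
  Poincaré chain of `(𝔻; 1, −1)` seen from the disc: renewal at singly crossed transversal
  geodesics / spectral gap of the axis transfer operator; Euclidean contraction near the ideal
  points gives uniform control of the two ends).
* `stub_axisInvariance : AxisInvariance` (L/XL) — every such weak limit is invariant under the
  stabiliser `Aut(𝔻; 1, −1)` (the hyperbolic translations along the axis), pushed along any
  continuous plane extension: the `ρ → 1⁻` limit is insensitive to moving the two ends separately
  (the approximants themselves are NOT invariant — the start bead sits at `ρ` — so this is a
  genuine mixing statement about the limit, the second half of the item's "why it might fail").
* PROVED glue `covariantTransport` (no `sorry`): a probability law on chordal curves of the closed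
  disc, invariant under `Aut(𝔻; 1, −1)`, is the disc value of a chordal, exactly conformally
  covariant `ChordalFamily` — Carathéodory transport data + Tietze, all from the tree
  (`Theorems/SAWPoincareChainDiscRestrictionIsSLETransport.lean`: `exists_transportData`,
  `exists_inverse`, `isChordal_transport`, `isConformallyCovariant_transport`; the disc value is
  `μ` itself by invariance, no special-casing of `D = 𝔻`).
* `ChainLaw_of` (kernel-checked, no `sorry`): eventually in `t`, disc limit + invariance + transport
  give a chordal covariant family through the limit; a `t`-wise classical choice assembles
  `Q : ℝ → ChordalFamily`, and the crux follows BY NAME (the normalised approximant unfolds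
  definitionally to the crux's inlined term).

## Disproof / negatives used
* `Cruxes/ChainLaw/Disproof.lean`: none exists yet (`ledger crux ls stmt-CriticalPhenomena-7556`:
  no workfiles at registration time) — nothing to honour; no `_false_without_` obstruction known.
* `ledger negatives --problem CriticalPhenomena` (11 entries, 2026-08-17): none concerns the
  Poincaré chain; the only SAW-tightness negative (stmt-0772, ALL-`δ` tightness on `ℤ²`) is avoided
  in kind — every statement here is EVENTUAL in `t` (`∀ᶠ t in 𝓝[>] 0`), and no tightness in `t` is
  asserted at all (that is crux `SubCurvatureTightness`, not this one).
* Vacuity pass: `DiscLimitExists` has no trivial witness (a weak limit of the normalised laws that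
  is a probability measure forces eventual non-degeneracy; the zero family is excluded by
  `IsProbabilityMeasure`); `AxisInvariance` is vacuous only if no limit exists, and is used only
  together with `DiscLimitExists`; `TwoPointFinite` quantifies over all starts `ρ ∈ (0,1)`.
-/

noncomputable section

open scoped BigOperators Topology Manifold Classical MeasureTheory ProbabilityTheory Matrix InnerProductSpace ComplexConjugate ContinuousMap
open Filter Set Function TopologicalSpace MeasureTheory
open Literature.Probability.RandomPlanarGeometry
open Summit.CriticalPhenomena.SAWScalingLimit.Theorems.DiscRestriction

namespace Summit.CriticalPhenomena.SAWScalingLimit.Cruxes.ChainLaw.Birth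

/-! ### 1. Vocabulary (verbatim from the crux) -/

/-- The UNNORMALISED `x_c`-weighted Poincaré tangent-bead chain measure of `(𝔻; 1, −1)` with step
parameter `t` (`t = tanh(ε/2)`), started at the bead `ρ = 1 − r`: sum over the number of steps `n`
of `(x_c/2π)^n ·` Lebesgue measure on the admissible angle sequences (hard core: pseudo-hyperbolic
distance `> t` between non-consecutive beads; last bead within pseudo-hyperbolic distance `1/2` of
`−ρ`), pushed to `CurveClass ℂ` as polylines; `x_c = 1/μ_flat` with `μ_flat` the relative
connective constant of the FLAT unit-step tangent-disc chain.  VERBATIM the inlined approximant of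
`SAWPoincareChain.ChainLaw` (so that `approxLaw` below unfolds to the crux's term). -/
def approximant (t r : ℝ) : MeasureTheory.Measure (Literature.Probability.RandomPlanarGeometry.CurveClass ℂ) :=
  ((fun (xc t ρ : ℝ) (pos : (ℕ → ℝ) → ℕ → ℂ) => MeasureTheory.Measure.sum fun n : ℕ => ENNReal.ofReal ((xc / (2 * Real.pi)) ^ n) • ((MeasureTheory.volume.restrict {θ : Fin n → ℝ | (∀ k, θ k ∈ Set.Ico (0:ℝ) (2 * Real.pi)) ∧ (∀ i j : ℕ, i + 2 ≤ j → j ≤ n → t * ‖1 - (starRingEnd ℂ) (pos (fun k => if h : k < n then θ ⟨k, h⟩ else 0) i) * pos (fun k => if h : k < n then θ ⟨k, h⟩ else 0) j‖ < ‖pos (fun k => if h : k < n then θ ⟨k, h⟩ else 0) i - pos (fun k => if h : k < n then θ ⟨k, h⟩ else 0) j‖) ∧ 2 * ‖pos (fun k => if h : k < n then θ ⟨k, h⟩ else 0) n + ↑ρ‖ ≤ ‖1 + ↑ρ * pos (fun k => if h : k < n then θ ⟨k, h⟩ else 0) n‖}).map (fun θ => Literature.Probability.RandomPlanarGeometry.CurveClass.mk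 (⟨Literature.Probability.LatticeModels.polyline ((List.range (n + 1)).map (pos (fun k => if h : k < n then θ ⟨k, h⟩ else 0)))⟩ : Literature.Probability.RandomPlanarGeometry.Curve ℂ)))) ((⨅ n : ℕ, ((MeasureTheory.volume {θ : Fin (n + 1) → ℝ | (∀ k, θ k ∈ Set.Ico (0:ℝ) (2 * Real.pi)) ∧ ∀ i j : ℕ, i + 2 ≤ j → j ≤ n + 1 → 1 < ‖(List.range i).foldl (fun (z : ℂ) (m : ℕ) => z + Complex.exp (↑(if h : m < n + 1 then θ ⟨m, h⟩ else 0) * Complex.I)) 0 - (List.range j).foldl (fun (z : ℂ) (m : ℕ) => z + Complex.exp (↑(if h : m < n + 1 then θ ⟨m, h⟩ else 0) * Complex.I)) 0‖}).toReal / (2 * Real.pi) ^ (n + 1)) ^ (1 / ((n : ℝ) + 1)))⁻¹) t (1 - r) (fun θ k => (List.range k).foldl (fun (z : ℂ) (j : ℕ) => (z + ↑t * Complex.exp (↑(θ j) * Complex.I)) / (1 + (starRingEnd ℂ) z * (↑t * Complex.exp (↑(θ j) * Complex.I)))) (↑(1 - r) : ℂ)))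

/-- The NORMALISED approximant law `Z(t, ρ)⁻¹ · approximant` (verbatim the crux's normalisation
`S ↦ (S univ)⁻¹ • S`). -/
def approxLaw (t r : ℝ) : MeasureTheory.Measure (Literature.Probability.RandomPlanarGeometry.CurveClass ℂ) :=
  (fun S : MeasureTheory.Measure (Literature.Probability.RandomPlanarGeometry.CurveClass ℂ) => (S Set.univ)⁻¹ • S) (approximant t r)

/-- STUB 1 statement — **two-point finiteness and non-degeneracy at the flat critical fugacity**:
for all small `t > 0` and every start `ρ = 1 − r ∈ (0, 1)` the grand-canonical mass `Z(t, ρ)` of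
the Poincaré chain from `ρ` to `B(−ρ, 1/2)` lies in `(0, ∞)`. -/
def TwoPointFinite : Prop :=
  ∀ᶠ t in nhdsWithin (0:ℝ) (Set.Ioi 0), ∀ r ∈ Set.Ioo (0:ℝ) 1,
    approximant t r Set.univ ≠ 0 ∧ approximant t r Set.univ ≠ ⊤

/-- STUB 2 conclusion — **the disc limit exists** ("axis renewal"): for all small `t > 0` the
normalised laws converge weakly, as the start bead `ρ = 1 − r → 1⁻`, to a probability law on
`CurveClass ℂ` carried by curves of the closed unit disc from `1 = 𝔻.pt 0` to `−1 = 𝔻.pt 1`. -/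
def DiscLimitExists : Prop :=
  ∀ᶠ t in nhdsWithin (0:ℝ) (Set.Ioi 0),
    ∃ μ : MeasureTheory.Measure (Literature.Probability.RandomPlanarGeometry.CurveClass ℂ),
      MeasureTheory.IsProbabilityMeasure μ ∧
      (∀ᵐ γ ∂μ, γ.source = Literature.Probability.RandomPlanarGeometry.DobrushinDomain.unitDisc.pt 0 ∧
        γ.target = Literature.Probability.RandomPlanarGeometry.DobrushinDomain.unitDisc.pt 1 ∧
        γ.range ⊆ closure Literature.Probability.RandomPlanarGeometry.DobrushinDomain.unitDisc.carrier) ∧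
      Literature.Probability.RandomPlanarGeometry.TendstoLaw
        (fun (_ : ℝ) (x : Literature.Probability.RandomPlanarGeometry.CurveClass ℂ) => x)
        (fun r => approxLaw t r) id μ

/-- STUB 3 statement — **axis invariance of the limit**: for all small `t > 0`, every weak limit
(as `ρ → 1⁻`) of the normalised laws that is a probability measure is invariant under the
stabiliser `Aut(𝔻; 1, −1)` (conformal automorphisms of the disc with boundary values `1 ↦ 1`,
`−1 ↦ −1`), pushed along any continuous map of the plane agreeing with the automorphism on `𝔻`. -/
def AxisInvariance : Prop :=
  ∀ᶠ t in nhdsWithin (0:ℝ) (Set.Ioi 0),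
    ∀ μ : MeasureTheory.Measure (Literature.Probability.RandomPlanarGeometry.CurveClass ℂ),
      MeasureTheory.IsProbabilityMeasure μ →
      Literature.Probability.RandomPlanarGeometry.TendstoLaw
        (fun (_ : ℝ) (x : Literature.Probability.RandomPlanarGeometry.CurveClass ℂ) => x)
        (fun r => approxLaw t r) id μ →
      ∀ (k : Literature.Probability.RandomPlanarGeometry.ConformalEquiv
          Literature.Probability.RandomPlanarGeometry.DobrushinDomain.unitDisc.carrier
          Literature.Probability.RandomPlanarGeometry.DobrushinDomain.unitDisc.carrier) (K : C(ℂ, ℂ)),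
        k.HasBoundaryValue (Literature.Probability.RandomPlanarGeometry.DobrushinDomain.unitDisc.pt 0)
          (Literature.Probability.RandomPlanarGeometry.DobrushinDomain.unitDisc.pt 0) →
        k.HasBoundaryValue (Literature.Probability.RandomPlanarGeometry.DobrushinDomain.unitDisc.pt 1)
          (Literature.Probability.RandomPlanarGeometry.DobrushinDomain.unitDisc.pt 1) →
        Set.EqOn K k Literature.Probability.RandomPlanarGeometry.DobrushinDomain.unitDisc.carrier →
        μ.map (Literature.Probability.RandomPlanarGeometry.CurveClass.map K) = μ

/-! ### 2. The registered stubs (the only `sorry`s of the file) -/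

/-- STUB 1 (L): two-point finiteness and non-degeneracy of the Poincaré chain at `x_c = 1/μ_flat`,
small `t`, every start `ρ ∈ (0, 1)`. -/
theorem stub_twoPointFinite : TwoPointFinite := by
  sorry

/-- STUB 2 (XL, HARDEST): axis renewal — given finiteness, the normalised chain laws converge
weakly as `ρ → 1⁻` to a probability law on chordal curves of `(𝔻; 1, −1)`. -/
theorem stub_discLimit : TwoPointFinite → DiscLimitExists := by
  sorry

/-- STUB 3 (L/XL): the `ρ → 1⁻` limit is invariant under the stabiliser `Aut(𝔻; 1, −1)`
(insensitivity to moving the two ends separately). -/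
theorem stub_axisInvariance : AxisInvariance := by
  sorry

/-! ### Name-keyed aliases of the stub statements (hypotheses of the composition)

`Registered.stub_X : Prop` is the statement of `stub_X` under the registered stub's short name, so
that the skeleton audit (`#h21_check_skeleton`: hypotheses admissible iff registered stubs BY NAME)
accepts `ChainLaw_of : Registered.stub_… → … → ChainLaw` (device of
`Cruxes/BoundaryClosure/Lines/two-root-quotient.lean`). -/
namespace Registered

/-- Alias keyed by the registered stub name. -/
abbrev stub_twoPointFinite : Prop := TwoPointFinite
/-- Alias keyed by the registered stub name. -/
abbrev stub_discLimit : Prop := TwoPointFinite → DiscLimitExists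
/-- Alias keyed by the registered stub name. -/
abbrev stub_axisInvariance : Prop := AxisInvariance

end Registered

/-! ### 3. The sorry-free part: covariant transport from the disc, and the composition -/

/-- **Covariant transport (PROVED glue).** A probability law on curves of the closed unit disc from
`1` to `−1`, invariant under `Aut(𝔻; 1, −1)` pushed along continuous extensions, is the disc value
of a chordal, exactly conformally covariant chordal family: `D ↦ (G_D)_* μ` along Carathéodory
transport data `G_D` (tree: `exists_transportData`, `exists_inverse`, `isChordal_transport`,
`isConformallyCovariant_transport`); at `D = 𝔻` the transport map extends an automorphism fixing
`±1`, so the value is `μ` by invariance. -/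
theorem covariantTransport
    (μ : MeasureTheory.Measure (Literature.Probability.RandomPlanarGeometry.CurveClass ℂ))
    (hprob : MeasureTheory.IsProbabilityMeasure μ)
    (hμ : ∀ᵐ γ ∂μ, γ.source = DobrushinDomain.unitDisc.pt 0 ∧
      γ.target = DobrushinDomain.unitDisc.pt 1 ∧
      γ.range ⊆ closure DobrushinDomain.unitDisc.carrier)
    (hInv : ∀ (k : ConformalEquiv DobrushinDomain.unitDisc.carrier DobrushinDomain.unitDisc.carrier)
        (K : C(ℂ, ℂ)),
      k.HasBoundaryValue (DobrushinDomain.unitDisc.pt 0) (DobrushinDomain.unitDisc.pt 0) →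
      k.HasBoundaryValue (DobrushinDomain.unitDisc.pt 1) (DobrushinDomain.unitDisc.pt 1) →
      Set.EqOn K k DobrushinDomain.unitDisc.carrier →
      μ.map (CurveClass.map K) = μ) :
    ∃ P : ChordalFamily, P.IsChordal ∧ P.IsConformallyCovariant ∧
      P DobrushinDomain.unitDisc = μ := by
  haveI := hprob
  choose g G hGg hb0 hb1 hG0 hG1 hinj _hmaps using exists_transportData
  choose Θ hΘc _hΘm hΘG _hGΘ hΘsymm _hΘmaps using
    fun D : DobrushinDomain => exists_inverse (hGg D) (hinj D)
  refine ⟨fun D => μ.map (CurveClass.map (G D)), ?_, ?_, ?_⟩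
  · exact isChordal_transport hμ hG0 hG1 fun D => mapsTo_closure (hGg D)
  · exact isConformallyCovariant_transport (hμ.mono fun γ hγ => hγ.2.2) hInv hGg
      (fun D => Fin.forall_fin_two.2 ⟨hb0 D, hb1 D⟩)
      (fun D => Fin.forall_fin_two.2 ⟨hG0 D, hG1 D⟩) hΘc hΘG hΘsymm
  · exact hInv (g _) (G _) (hb0 _) (hb1 _) (hGg _)

/-- **The composition (kernel-checked, no `sorry`)**: the three stubs imply the crux `ChainLaw`
BY NAME.  Eventually in `t`: STUB 2 (fed by STUB 1) gives the disc limit `μ_t`, STUB 3 its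
`Aut(𝔻; 1, −1)`-invariance, `covariantTransport` a chordal, exactly covariant family `P_t` with
`P_t 𝔻 = μ_t`; a `t`-wise classical choice assembles `Q`, and the normalised approximant
`approxLaw` unfolds definitionally to the crux's inlined term. -/
theorem ChainLaw_of (h1 : Registered.stub_twoPointFinite) (h2 : Registered.stub_discLimit)
    (h3 : Registered.stub_axisInvariance) :
    Summit.CriticalPhenomena.SAWScalingLimit.Theses.SAWPoincareChain.ChainLaw := by
  classical
  -- eventually in `t`: a chordal, exactly covariant family through the disc limit
  have hev : ∀ᶠ t in nhdsWithin (0:ℝ) (Set.Ioi 0), ∃ P : ChordalFamily,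
      P.IsChordal ∧ P.IsConformallyCovariant ∧
        TendstoLaw (fun (_ : ℝ) (x : CurveClass ℂ) => x) (fun r => approxLaw t r) id
          (P DobrushinDomain.unitDisc) := by
    filter_upwards [h2 h1, h3] with t ht hinv
    obtain ⟨μ, hμ, hch, hlim⟩ := ht
    obtain ⟨P, hP, hPc, hPd⟩ := covariantTransport μ hμ hch (hinv μ hμ hlim)
    refine ⟨P, hP, hPc, ?_⟩
    rw [hPd]
    exact hlim
  -- assemble `Q` by a `t`-wise choice (junk value `0` where no such family exists)
  refine ⟨fun t => if h : ∃ P : ChordalFamily, P.IsChordal ∧ P.IsConformallyCovariant ∧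
      TendstoLaw (fun (_ : ℝ) (x : CurveClass ℂ) => x) (fun r => approxLaw t r) id
        (P DobrushinDomain.unitDisc) then h.choose else fun _ => 0, ?_⟩
  filter_upwards [hev] with t ht
  rw [dif_pos ht]
  exact ht.choose_spec

/-- Wiring check: the registered stubs feed `ChainLaw_of` as stated. -/
example : Summit.CriticalPhenomena.SAWScalingLimit.Theses.SAWPoincareChain.ChainLaw :=
  ChainLaw_of stub_twoPointFinite stub_discLimit stub_axisInvariance

end Summit.CriticalPhenomena.SAWScalingLimit.Cruxes.ChainLaw.Birth

end
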